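import Summits.ValiantsHypothesis.ValiantsHypothesis.Theorems.LacunarySymmetroidMatrixDescartesPivotBilinearAllModel
import Summits.ValiantsHypothesis.ValiantsHypothesis.Theorems.LacunarySymmetroidMatrixDescartesWLawArrowLetters
import Summits.ValiantsHypothesis.ValiantsHypothesis.Theorems.LacunarySymmetroidMatrixDescartesStubPsdBlocks
import Summits.ValiantsHypothesis.ValiantsHypothesis.Theorems.LacunarySymmetroidMatrixDescartesCensusPivotKit

/-!
# `MatrixDescartes` (stmt-ValiantsHypothesis-18050) — POLE WEAVING STACKED, the letters: an index-one arrowhead pivot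
# pencil of size `k + 1` with `K = c + 1` PSD letters whose determinant is `(∏ mᵢ)·x·(M(x) + s x^T)`

HONEST FRAMING.  Cell `pub-symmetroid`, seat `val-sym-mdr-p2` (gen 24); helper file `--supports` the crux
`Theses.LacunarySymmetroid.MatrixDescartes` (OPEN), NO closure claim.  Linear-algebra half of the all-`(m, K)` lower bound
(companion `…PivotBilinearAll`): the arrowhead design of `…WLawArrowLetters` / `…PivotArrowFourLetters` (seat g8) with the
pole-weaving block of `…PivotBilinearAllModel` in each of `k` block coordinates at scales `Ξᵢ`.  Letters (size `k + 1`, index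
`Fin k ⊕ Fin 1`, hub last): for the letter of exponent `d` and coefficient `q` (`q = 1/8` at `d = 0`, `q = 8n_l` at `d = n_l`)
the block diagonal is `(q/2)·Ξᵢ/Ξᵢ^d`, the border `±q·Ξᵢ/Ξᵢ^d` (`+` below, `−` above), the corner `Σᵢ 2q Ξᵢ/Ξᵢ^d` plus `1` (below
letter) or the slack `s` (top letter) — Schur complements `1, 0, …, 0, s`, so PSD (`posSemidef_letter`); pivot
`J = diag(1/8, …, 1/8, −1 − k/2)` (index one, `indexOne_stackedJ`).  Then (`det_pencil_eval`, via the tree's `WLawArrow.det_arrow`)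
`det(x J + Σ_l x^{d_l} P_l) = (∏ᵢ (Ξᵢ/2) m(x/Ξᵢ)) · x · (M(x) + s x^{n_{c−1} − 1})` for `x > 0`, `M` the stacked model.
Nothing here bears on `MatrixDescartes` in its window, the upper pivot rungs, `DoorA26`/`DoorA34`, the registers, `VP ≠ VNP`.
[folklore] Schur complement / arrowhead determinant over Mathlib; tree inputs `WLawArrow.posSemidef_arrow`, `WLawArrow.det_arrow`,
`posSemidef_fromBlocks_zero`, `Pivot.eval_det_pivot`.
-/

set_option linter.dupNamespace false

namespace Summit.ValiantsHypothesis.ValiantsHypothesis.Theorems.LacunarySymmetroidMatrixDescartes.Pivot.PoleWeave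

open scoped BigOperators Matrix
open Finset Matrix Polynomial

/-! ### Notation (local, no definitions) -/

/-- The scale `S = 2^{c+7}`. -/
local notation3 (prettyPrint := false) "S⟦" c "⟧" => (2 ^ (c + 7))

/-- The exponents `nᵢ = (S²)^{i+1}`. -/
local notation3 (prettyPrint := false) "n⟦" c ", " i "⟧" => ((S⟦c⟧ * S⟦c⟧) ^ (i + 1))

/-- `Ã(y) = Σ 8nᵢ y^{nᵢ−1}`. -/
local notation3 (prettyPrint := false) "Ã⟦" c "⟧(" y ")" =>
  (∑ i : Fin c, (8 * (n⟦c, (i : ℕ)⟧ : ℝ)) * (y : ℝ) ^ (n⟦c, (i : ℕ)⟧ - 1))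

/-- `m(y) = 1/8 + y/4 + y Ã(y)`. -/
local notation3 (prettyPrint := false) "m⟦" c "⟧(" y ")" => ((1 : ℝ) / 8 + (y : ℝ) / 4 + (y : ℝ) * Ã⟦c⟧(y))

/-- `φ(y) = (Ã(y)/2 − y/16)/m(y)`. -/
local notation3 (prettyPrint := false) "φ⟦" c "⟧(" y ")" => ((Ã⟦c⟧(y) / 2 - (y : ℝ) / 16) / m⟦c⟧(y))

/-- The stacked model `M(x) = x⁻¹ − 1 + Σᵢ 2 φ(x/Ξᵢ)`. -/
local notation3 (prettyPrint := false) "M⟦" c ", " Ξ "⟧(" x ")" =>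
  ((x : ℝ)⁻¹ - 1 + ∑ i, 2 * φ⟦c⟧((x : ℝ) / (Ξ : Fin _ → ℝ) i))

/-- Coefficients `q_l` of the `K = c + 1` letters: `1/8` (below), `8 n_{l'}` (above). -/
local notation3 (prettyPrint := false) "qw⟦" c "⟧" =>
  (Fin.cons ((1 : ℝ) / 8) (fun l : Fin c => (8 * (n⟦c, (l : ℕ)⟧ : ℝ))) : Fin (c + 1) → ℝ)

/-- Exponents `(0, n₀, …, n_{c−1})`. -/
local notation3 (prettyPrint := false) "dw⟦" c "⟧" =>
  (Fin.cons 0 (fun l : Fin c => n⟦c, (l : ℕ)⟧) : Fin (c + 1) → ℕ)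

/-- Border signs: `+` below, `−` above. -/
local notation3 (prettyPrint := false) "σw⟦" c "⟧" =>
  (Fin.cons (1 : ℝ) (fun _ : Fin c => (-1 : ℝ)) : Fin (c + 1) → ℝ)

/-- Corner extras: `1` on the below letter, the slack `s` on the top letter, `0` elsewhere. -/
local notation3 (prettyPrint := false) "ew⟦" c ", " s "⟧" =>
  (Fin.cons (1 : ℝ) (fun l : Fin c => if (l : ℕ) + 1 = c then (s : ℝ) else 0) : Fin (c + 1) → ℝ)

/-- Reindexing `Fin k ⊕ Fin 1 ≃ Fin (k + 1)`. -/
local notation3 (prettyPrint := false) "rx[" A "]" => Matrix.reindex finSumFinEquiv finSumFinEquiv A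

/-- The arrowhead letter `l` (block diagonal `(q/2)Ξᵢ/Ξᵢ^d`, border `σ q Ξᵢ/Ξᵢ^d`, corner `Σ 2qΞᵢ/Ξᵢ^d + extra`). -/
local notation3 (prettyPrint := false) "Lw⟦" c ", " Ξ ", " s "⟧(" l ")" =>
  (Matrix.fromBlocks (diagonal fun i : Fin _ => qw⟦c⟧ l / 2 * ((Ξ : Fin _ → ℝ) i / (Ξ : Fin _ → ℝ) i ^ (dw⟦c⟧ l)))
    (Matrix.of fun (i : Fin _) (_ : Fin 1) => σw⟦c⟧ l * qw⟦c⟧ l * ((Ξ : Fin _ → ℝ) i / (Ξ : Fin _ → ℝ) i ^ (dw⟦c⟧ l)))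
    (Matrix.of fun (_ : Fin 1) (i : Fin _) => σw⟦c⟧ l * qw⟦c⟧ l * ((Ξ : Fin _ → ℝ) i / (Ξ : Fin _ → ℝ) i ^ (dw⟦c⟧ l)))
    (Matrix.of fun (_ _ : Fin 1) => (∑ i, 2 * qw⟦c⟧ l * ((Ξ : Fin _ → ℝ) i / (Ξ : Fin _ → ℝ) i ^ (dw⟦c⟧ l))) + ew⟦c, s⟧ l))

/-- The pivot `J = diag(1/8, …, 1/8, −1 − k/2)`. -/
local notation3 (prettyPrint := false) "Jw⟦" k "⟧" =>
  (Matrix.fromBlocks (diagonal fun _ : Fin k => (1 : ℝ) / 8) 0 0 (Matrix.of fun (_ _ : Fin 1) => -1 - (k : ℝ) / 2))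

/-! ### 1. Positive semidefiniteness, symmetry, index one -/

/-- The coefficients are positive. -/
theorem qw_pos (c : ℕ) (l : Fin (c + 1)) : 0 < qw⟦c⟧ l := by
  refine Fin.cases ?_ (fun l => ?_) l
  · simp
  · simp only [Fin.cons_succ]
    have : (1 : ℝ) ≤ (n⟦c, (l : ℕ)⟧ : ℝ) := by exact_mod_cast one_le_n c l
    linarith

/-- The border signs square to one. -/
theorem σw_sq (c : ℕ) (l : Fin (c + 1)) : σw⟦c⟧ l * σw⟦c⟧ l = 1 := by
  refine Fin.cases ?_ (fun l => ?_) l <;> simp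

/-- The corner extras are nonnegative for `s ≥ 0`. -/
theorem ew_nonneg (c : ℕ) {s : ℝ} (hs : 0 ≤ s) (l : Fin (c + 1)) : 0 ≤ ew⟦c, s⟧ l := by
  refine Fin.cases ?_ (fun l => ?_) l
  · simp
  · simp only [Fin.cons_succ]; split_ifs <;> simp [hs]

/-- **The letters are PSD** (arrowhead with Schur complement `= extra ≥ 0`). -/
theorem posSemidef_letter (c : ℕ) {k : ℕ} (Ξ : Fin k → ℝ) (hΞ : ∀ i, 0 < Ξ i) {s : ℝ} (hs : 0 ≤ s)
    (l : Fin (c + 1)) : (rx[Lw⟦c, Ξ, s⟧(l)]).PosSemidef := by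
  rw [Matrix.reindex_apply]
  refine Matrix.PosSemidef.submatrix ?_ _
  have hq := qw_pos c l
  refine WLawArrow.posSemidef_arrow _ _ _ (fun i => by have := hΞ i; positivity) ?_
  have : ∑ i, (σw⟦c⟧ l * qw⟦c⟧ l * (Ξ i / Ξ i ^ (dw⟦c⟧ l))) ^ 2 / (qw⟦c⟧ l / 2 * (Ξ i / Ξ i ^ (dw⟦c⟧ l)))
      = ∑ i, 2 * qw⟦c⟧ l * (Ξ i / Ξ i ^ (dw⟦c⟧ l)) := by
    refine Finset.sum_congr rfl fun i _ => ?_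
    have h1 : 0 < Ξ i / Ξ i ^ (dw⟦c⟧ l) := by have := hΞ i; positivity
    have hσ := σw_sq c l
    generalize Ξ i / Ξ i ^ (dw⟦c⟧ l) = r at h1 ⊢
    generalize σw⟦c⟧ l = σ at hσ ⊢
    generalize qw⟦c⟧ l = q at hq ⊢
    rw [show (σ * q * r) ^ 2 = (σ * σ) * (q * r) ^ 2 by ring, hσ, one_mul]
    field_simp
  rw [this]
  have := ew_nonneg c hs l
  linarith

/-- The letters are symmetric. -/
theorem isSymm_letter (c : ℕ) {k : ℕ} (Ξ : Fin k → ℝ) (s : ℝ) (l : Fin (c + 1)) : (rx[Lw⟦c, Ξ, s⟧(l)]).IsSymm := by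
  rw [Matrix.reindex_apply]
  exact (WLawArrow.isSymm_arrow _ _ _).submatrix _

/-- `J` is symmetric. -/
theorem isSymm_stackedJ (k : ℕ) : (rx[Jw⟦k⟧]).IsSymm := by
  rw [Matrix.reindex_apply]
  refine Matrix.IsSymm.submatrix ?_ _
  refine Matrix.IsSymm.fromBlocks (isSymm_diagonal _) (by simp) ?_
  ext i j; fin_cases i; fin_cases j; rfl

/-- **The pivot has index one**: `J + W Wᵀ ⪰ 0` for `W = (0, …, 0, √(1 + k/2))ᵀ`. -/
theorem indexOne_stackedJ (k : ℕ) : ∃ W : Matrix (Fin (k + 1)) (Fin 1) ℝ, (rx[Jw⟦k⟧] + W * Wᵀ).PosSemidef := by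
  set a : ℝ := 1 + (k : ℝ) / 2 with ha
  have ha0 : 0 ≤ a := by rw [ha]; positivity
  set W₀ : Matrix (Fin k ⊕ Fin 1) (Fin 1) ℝ := Matrix.of (Sum.elim (fun _ _ => (0 : ℝ)) fun _ _ => Real.sqrt a)
    with hW₀
  refine ⟨W₀.submatrix finSumFinEquiv.symm (Equiv.refl (Fin 1)), ?_⟩
  have hblock : Jw⟦k⟧ + W₀ * W₀ᵀ
      = Matrix.fromBlocks (diagonal fun _ : Fin k => (1 : ℝ) / 8) 0 0 (0 : Matrix (Fin 1) (Fin 1) ℝ) := by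
    ext i j
    rcases i with i | i <;> rcases j with j | j
    · simp [hW₀, Matrix.mul_apply, Matrix.fromBlocks]
    · simp [hW₀, Matrix.mul_apply, Matrix.fromBlocks]
    · simp [hW₀, Matrix.mul_apply, Matrix.fromBlocks]
    · simp only [hW₀, Matrix.add_apply, Matrix.fromBlocks_apply₂₂, Matrix.of_apply, Matrix.mul_apply,
        Matrix.transpose_apply, Sum.elim_inr, Finset.sum_const, Finset.card_univ, Fintype.card_fin,
        nsmul_eq_mul, Nat.cast_one, one_mul, Matrix.zero_apply]
      rw [Real.mul_self_sqrt ha0, ha]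
      ring
  have hrx : rx[Jw⟦k⟧] + W₀.submatrix finSumFinEquiv.symm (Equiv.refl (Fin 1))
        * (W₀.submatrix finSumFinEquiv.symm (Equiv.refl (Fin 1)))ᵀ = rx[Jw⟦k⟧ + W₀ * W₀ᵀ] := by
    rw [Matrix.transpose_submatrix, Matrix.reindex_apply, Matrix.reindex_apply, Matrix.submatrix_add]
    congr 1
  rw [hrx, hblock, Matrix.reindex_apply]
  refine Matrix.PosSemidef.submatrix ?_ _
  exact posSemidef_fromBlocks_zero (posSemidef_diagonal_iff.2 fun _ => by norm_num) Matrix.PosSemidef.zero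

/-! ### 2. The pencil as one arrowhead matrix -/

/-- Reindexing commutes with forming the pencil. [bookkeeping] -/
theorem reindex_pencil {k c : ℕ} (J : Matrix (Fin k ⊕ Fin 1) (Fin k ⊕ Fin 1) ℝ)
    (L : Fin (c + 1) → Matrix (Fin k ⊕ Fin 1) (Fin k ⊕ Fin 1) ℝ) (w : Fin (c + 1) → ℝ) (x : ℝ) :
    x • rx[J] + ∑ l, w l • rx[L l] = rx[x • J + ∑ l, w l • L l] := by
  ext i j
  simp [Matrix.reindex_apply, Matrix.sum_apply]

/-- Summing scaled arrowhead matrices gives the arrowhead matrix of the sums. [bookkeeping] -/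
theorem sum_smul_arrow {k c : ℕ} (w : Fin (c + 1) → ℝ) (α β : Fin (c + 1) → Fin k → ℝ) (γ : Fin (c + 1) → ℝ)
    (x j0 jh : ℝ) :
    x • Matrix.fromBlocks (diagonal fun _ : Fin k => j0) 0 0 (Matrix.of fun (_ _ : Fin 1) => jh)
      + ∑ l, w l • Matrix.fromBlocks (diagonal (α l)) (Matrix.of fun (i : Fin k) (_ : Fin 1) => β l i)
          (Matrix.of fun (_ : Fin 1) (i : Fin k) => β l i) (Matrix.of fun (_ _ : Fin 1) => γ l)
      = Matrix.fromBlocks (diagonal fun i => x * j0 + ∑ l, w l * α l i)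
          (Matrix.of fun (i : Fin k) (_ : Fin 1) => ∑ l, w l * β l i)
          (Matrix.of fun (_ : Fin 1) (i : Fin k) => ∑ l, w l * β l i)
          (Matrix.of fun (_ _ : Fin 1) => x * jh + ∑ l, w l * γ l) := by
  ext i j
  rcases i with i | i <;> rcases j with j | j
  · by_cases hij : i = j
    · subst hij
      simp [Matrix.sum_apply, Matrix.fromBlocks, Matrix.diagonal]
    · simp [Matrix.sum_apply, Matrix.fromBlocks, Matrix.diagonal, hij]
  · simp [Matrix.sum_apply, Matrix.fromBlocks]
  · simp [Matrix.sum_apply, Matrix.fromBlocks]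
  · simp [Matrix.sum_apply, Matrix.fromBlocks]

/-! ### 3. The entries of the pencil in block form -/

/-- Rescaling a monomial to the block variable `y = x/Ξ`: `x^d · (Ξ/Ξ^d) = Ξ · (x/Ξ)^d`. -/
theorem scale_pow {Ξ : ℝ} (hΞ : Ξ ≠ 0) (x : ℝ) (d : ℕ) : x ^ d * (Ξ / Ξ ^ d) = Ξ * (x / Ξ) ^ d := by
  rw [div_pow]; field_simp

/-- The block diagonal entry is `(Ξᵢ/2)·m(x/Ξᵢ)`. -/
theorem mblk_eq (c : ℕ) {Ξ : ℝ} (hΞ : 0 < Ξ) (x : ℝ) :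
    x ^ 1 * ((1 : ℝ) / 8) + ∑ l : Fin (c + 1), x ^ (dw⟦c⟧ l) * (qw⟦c⟧ l / 2 * (Ξ / Ξ ^ (dw⟦c⟧ l)))
      = Ξ / 2 * m⟦c⟧(x / Ξ) := by
  rw [Fin.sum_univ_succ]
  simp only [Fin.cons_zero, Fin.cons_succ, pow_zero, pow_one, div_one, one_mul]
  rw [mul_A c (x / Ξ), mul_add, mul_add, Finset.mul_sum]
  have hterm : ∀ l : Fin c, x ^ (n⟦c, (l : ℕ)⟧) * ((8 * (n⟦c, (l : ℕ)⟧ : ℝ)) / 2 * (Ξ / Ξ ^ (n⟦c, (l : ℕ)⟧)))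
      = Ξ / 2 * ((8 * (n⟦c, (l : ℕ)⟧ : ℝ)) * (x / Ξ) ^ (n⟦c, (l : ℕ)⟧)) := by
    intro l
    have := scale_pow hΞ.ne' x (n⟦c, (l : ℕ)⟧)
    calc x ^ (n⟦c, (l : ℕ)⟧) * ((8 * (n⟦c, (l : ℕ)⟧ : ℝ)) / 2 * (Ξ / Ξ ^ (n⟦c, (l : ℕ)⟧)))
        = (8 * (n⟦c, (l : ℕ)⟧ : ℝ)) / 2 * (x ^ (n⟦c, (l : ℕ)⟧) * (Ξ / Ξ ^ (n⟦c, (l : ℕ)⟧))) := by ring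
      _ = Ξ / 2 * ((8 * (n⟦c, (l : ℕ)⟧ : ℝ)) * (x / Ξ) ^ (n⟦c, (l : ℕ)⟧)) := by rw [this]; ring
  rw [Finset.sum_congr rfl fun l _ => hterm l]
  have hx : Ξ / 2 * ((x / Ξ) / 4) = x / 8 := by field_simp; ring
  rw [hx]; ring

/-- The border entry is `Ξᵢ·(1/8 − (x/Ξᵢ)·Ã(x/Ξᵢ))`. -/
theorem border_eq (c : ℕ) {Ξ : ℝ} (hΞ : 0 < Ξ) (x : ℝ) :
    ∑ l : Fin (c + 1), x ^ (dw⟦c⟧ l) * (σw⟦c⟧ l * qw⟦c⟧ l * (Ξ / Ξ ^ (dw⟦c⟧ l)))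
      = Ξ * ((1 : ℝ) / 8 - (x / Ξ) * Ã⟦c⟧(x / Ξ)) := by
  rw [Fin.sum_univ_succ]
  simp only [Fin.cons_zero, Fin.cons_succ, pow_zero, div_one, one_mul]
  rw [mul_A c (x / Ξ), mul_sub, Finset.mul_sum]
  have hterm : ∀ l : Fin c, x ^ (n⟦c, (l : ℕ)⟧) * (-1 * (8 * (n⟦c, (l : ℕ)⟧ : ℝ)) * (Ξ / Ξ ^ (n⟦c, (l : ℕ)⟧)))
      = -(Ξ * ((8 * (n⟦c, (l : ℕ)⟧ : ℝ)) * (x / Ξ) ^ (n⟦c, (l : ℕ)⟧))) := by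
    intro l
    have := scale_pow hΞ.ne' x (n⟦c, (l : ℕ)⟧)
    calc x ^ (n⟦c, (l : ℕ)⟧) * (-1 * (8 * (n⟦c, (l : ℕ)⟧ : ℝ)) * (Ξ / Ξ ^ (n⟦c, (l : ℕ)⟧)))
        = -((8 * (n⟦c, (l : ℕ)⟧ : ℝ)) * (x ^ (n⟦c, (l : ℕ)⟧) * (Ξ / Ξ ^ (n⟦c, (l : ℕ)⟧)))) := by ring
      _ = -(Ξ * ((8 * (n⟦c, (l : ℕ)⟧ : ℝ)) * (x / Ξ) ^ (n⟦c, (l : ℕ)⟧))) := by rw [this]; ring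
  rw [Finset.sum_congr rfl fun l _ => hterm l, Finset.sum_neg_distrib]
  ring

/-- The slack picks out the top letter: `Σ_{l'} x^{n_{l'}} · (extra) = s·x^{n_{c−1}}` (`c ≥ 1`). -/
theorem slack_sum (c : ℕ) (hc : 1 ≤ c) (s x : ℝ) :
    ∑ l : Fin c, x ^ (n⟦c, (l : ℕ)⟧) * (if (l : ℕ) + 1 = c then s else 0) = s * x ^ (n⟦c, c - 1⟧) := by
  rw [Finset.sum_eq_single ⟨c - 1, by omega⟩]
  · simp only [show c - 1 + 1 = c by omega, if_true]; ring
  · intro l _ hl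
    have : ¬ ((l : ℕ) + 1 = c) := fun h => hl (Fin.ext (by simp; omega))
    simp [this]
  · intro h; exact absurd (Finset.mem_univ _) h

/-- The corner entry is `1 − x + s x^{n_{c−1}} + Σᵢ (Ξᵢ/4 − x/2 + 2Ξᵢ·(x/Ξᵢ)Ã(x/Ξᵢ))` (`c ≥ 1`). -/
theorem corner_eq (c : ℕ) (hc : 1 ≤ c) {k : ℕ} (Ξ : Fin k → ℝ) (hΞ : ∀ i, 0 < Ξ i) (s x : ℝ) :
    x ^ 1 * (-1 - (k : ℝ) / 2)
        + ∑ l : Fin (c + 1), x ^ (dw⟦c⟧ l) * ((∑ i, 2 * qw⟦c⟧ l * (Ξ i / Ξ i ^ (dw⟦c⟧ l))) + ew⟦c, s⟧ l)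
      = 1 - x + s * x ^ (n⟦c, c - 1⟧) + ∑ i, (Ξ i / 4 - x / 2 + 2 * Ξ i * ((x / Ξ i) * Ã⟦c⟧(x / Ξ i))) := by
  rw [Fin.sum_univ_succ]
  simp only [Fin.cons_zero, Fin.cons_succ, pow_zero, pow_one, div_one, one_mul]
  -- the above letters: split the extra (slack) from the block sums, and swap the two sums
  have hsplit : ∑ l : Fin c, x ^ (n⟦c, (l : ℕ)⟧) *
        ((∑ i, 2 * (8 * (n⟦c, (l : ℕ)⟧ : ℝ)) * (Ξ i / Ξ i ^ (n⟦c, (l : ℕ)⟧))) + (if (l : ℕ) + 1 = c then s else 0))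
      = (∑ i, 2 * Ξ i * ((x / Ξ i) * Ã⟦c⟧(x / Ξ i))) + s * x ^ (n⟦c, c - 1⟧) := by
    simp only [mul_add, Finset.sum_add_distrib, slack_sum c hc s x]
    congr 1
    rw [Finset.sum_congr rfl fun l _ => (Finset.mul_sum _ _ _), Finset.sum_comm]
    refine Finset.sum_congr rfl fun i _ => ?_
    rw [mul_A c (x / Ξ i), Finset.mul_sum]
    refine Finset.sum_congr rfl fun l _ => ?_
    have := scale_pow (hΞ i).ne' x (n⟦c, (l : ℕ)⟧)
    calc x ^ (n⟦c, (l : ℕ)⟧) * (2 * (8 * (n⟦c, (l : ℕ)⟧ : ℝ)) * (Ξ i / Ξ i ^ (n⟦c, (l : ℕ)⟧)))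
        = 2 * (8 * (n⟦c, (l : ℕ)⟧ : ℝ)) * (x ^ (n⟦c, (l : ℕ)⟧) * (Ξ i / Ξ i ^ (n⟦c, (l : ℕ)⟧))) := by ring
      _ = 2 * Ξ i * ((8 * (n⟦c, (l : ℕ)⟧ : ℝ)) * (x / Ξ i) ^ (n⟦c, (l : ℕ)⟧)) := by rw [this]; ring
  rw [hsplit]
  have hk : x * (-1 - (k : ℝ) / 2) = -x - ∑ _i : Fin k, x / 2 := by
    simp [Finset.sum_const, Finset.card_univ, Fintype.card_fin]; ring
  have h4 : ∑ i, 2 * ((1 : ℝ) / 8) * Ξ i = ∑ i, Ξ i / 4 := Finset.sum_congr rfl fun i _ => by ring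
  rw [hk, h4, Finset.sum_add_distrib, Finset.sum_sub_distrib]
  ring

/-- **Block identity**: the hub sees `2x·φ(x/Ξᵢ)` from block `i`. -/
theorem block_identity (c : ℕ) {Ξ x : ℝ} (hΞ : 0 < Ξ) (hx : 0 < x) :
    Ξ / 4 - x / 2 + 2 * Ξ * ((x / Ξ) * Ã⟦c⟧(x / Ξ))
        - (Ξ * ((1 : ℝ) / 8 - (x / Ξ) * Ã⟦c⟧(x / Ξ))) ^ 2 / (Ξ / 2 * m⟦c⟧(x / Ξ))
      = x * (2 * φ⟦c⟧(x / Ξ)) := by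
  have hy : 0 < x / Ξ := div_pos hx hΞ
  have hm := (m_pos c hy.le).ne'
  have hA := A_nonneg c hy.le
  generalize hAt : Ã⟦c⟧(x / Ξ) = At at hm hA ⊢
  have hΞ0 := hΞ.ne'
  field_simp
  ring

/-! ### 4. The pencil is one arrowhead matrix; its determinant -/

/-- **The pencil in block form** (raw sums). [bookkeeping] -/
theorem pencil_eq (c : ℕ) {k : ℕ} (Ξ : Fin k → ℝ) (s x : ℝ) :
    x ^ 1 • rx[Jw⟦k⟧] + ∑ l, x ^ (dw⟦c⟧ l) • rx[Lw⟦c, Ξ, s⟧(l)]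
      = rx[Matrix.fromBlocks
          (diagonal fun i => x ^ 1 * ((1 : ℝ) / 8)
            + ∑ l, x ^ (dw⟦c⟧ l) * (qw⟦c⟧ l / 2 * (Ξ i / Ξ i ^ (dw⟦c⟧ l))))
          (Matrix.of fun (i : Fin k) (_ : Fin 1) =>
            ∑ l, x ^ (dw⟦c⟧ l) * (σw⟦c⟧ l * qw⟦c⟧ l * (Ξ i / Ξ i ^ (dw⟦c⟧ l))))
          (Matrix.of fun (_ : Fin 1) (i : Fin k) =>
            ∑ l, x ^ (dw⟦c⟧ l) * (σw⟦c⟧ l * qw⟦c⟧ l * (Ξ i / Ξ i ^ (dw⟦c⟧ l))))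
          (Matrix.of fun (_ _ : Fin 1) => x ^ 1 * (-1 - (k : ℝ) / 2)
            + ∑ l, x ^ (dw⟦c⟧ l) * ((∑ i, 2 * qw⟦c⟧ l * (Ξ i / Ξ i ^ (dw⟦c⟧ l))) + ew⟦c, s⟧ l))] := by
  rw [reindex_pencil, sum_smul_arrow]

/-- **Schur complement of the hub** = `x·(M(x) + s x^{n_{c−1} − 1})` (`c ≥ 1`, `x > 0`). -/
theorem schur_eq (c : ℕ) (hc : 1 ≤ c) {k : ℕ} (Ξ : Fin k → ℝ) (hΞ : ∀ i, 0 < Ξ i) (s : ℝ) {x : ℝ}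
    (hx : 0 < x) :
    (x ^ 1 * (-1 - (k : ℝ) / 2)
        + ∑ l, x ^ (dw⟦c⟧ l) * ((∑ i, 2 * qw⟦c⟧ l * (Ξ i / Ξ i ^ (dw⟦c⟧ l))) + ew⟦c, s⟧ l))
      - ∑ i, (∑ l, x ^ (dw⟦c⟧ l) * (σw⟦c⟧ l * qw⟦c⟧ l * (Ξ i / Ξ i ^ (dw⟦c⟧ l)))) ^ 2
          / (x ^ 1 * ((1 : ℝ) / 8) + ∑ l, x ^ (dw⟦c⟧ l) * (qw⟦c⟧ l / 2 * (Ξ i / Ξ i ^ (dw⟦c⟧ l))))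
      = x * (M⟦c, Ξ⟧(x) + s * x ^ (n⟦c, c - 1⟧ - 1)) := by
  rw [corner_eq c hc Ξ hΞ s x]
  have hsum : ∑ i, (∑ l, x ^ (dw⟦c⟧ l) * (σw⟦c⟧ l * qw⟦c⟧ l * (Ξ i / Ξ i ^ (dw⟦c⟧ l)))) ^ 2
          / (x ^ 1 * ((1 : ℝ) / 8) + ∑ l, x ^ (dw⟦c⟧ l) * (qw⟦c⟧ l / 2 * (Ξ i / Ξ i ^ (dw⟦c⟧ l))))
      = ∑ i, (Ξ i * ((1 : ℝ) / 8 - (x / Ξ i) * Ã⟦c⟧(x / Ξ i))) ^ 2 / (Ξ i / 2 * m⟦c⟧(x / Ξ i)) := by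
    refine Finset.sum_congr rfl fun i _ => ?_
    rw [border_eq c (hΞ i), mblk_eq c (hΞ i)]
  rw [hsum, add_sub_assoc, ← Finset.sum_sub_distrib,
    Finset.sum_congr rfl fun i _ => block_identity c (hΞ i) hx, ← Finset.mul_sum]
  have hN : 1 ≤ n⟦c, c - 1⟧ := one_le_n c (c - 1)
  have hxN : x ^ (n⟦c, c - 1⟧) = x * x ^ (n⟦c, c - 1⟧ - 1) := by
    rw [← pow_succ', Nat.sub_add_cancel hN]
  rw [hxN]
  field_simp
  ring

/-- The block diagonal entries are positive at `x ≥ 0`. -/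
theorem mblk_pos (c : ℕ) {k : ℕ} (Ξ : Fin k → ℝ) (hΞ : ∀ i, 0 < Ξ i) {x : ℝ} (hx : 0 ≤ x) (i : Fin k) :
    0 < x ^ 1 * ((1 : ℝ) / 8) + ∑ l, x ^ (dw⟦c⟧ l) * (qw⟦c⟧ l / 2 * (Ξ i / Ξ i ^ (dw⟦c⟧ l))) := by
  rw [mblk_eq c (hΞ i)]
  exact mul_pos (by have := hΞ i; positivity) (m_pos c (div_nonneg hx (hΞ i).le))

/-- **The determinant of the stacked pole-weaving pencil at `x > 0`** is
`(∏ᵢ (Ξᵢ/2) m(x/Ξᵢ)) · x · (M(x) + s x^{n_{c−1}−1})`. -/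
theorem det_pencil_eval (c : ℕ) (hc : 1 ≤ c) {k : ℕ} (Ξ : Fin k → ℝ) (hΞ : ∀ i, 0 < Ξ i) (s : ℝ)
    {x : ℝ} (hx : 0 < x) :
    (Matrix.det (((X : ℝ[X]) ^ 1) • (rx[Jw⟦k⟧]).map Polynomial.C
        + ∑ l, ((X : ℝ[X]) ^ (dw⟦c⟧ l)) • (rx[Lw⟦c, Ξ, s⟧(l)]).map Polynomial.C)).eval x
      = (∏ i, Ξ i / 2 * m⟦c⟧(x / Ξ i)) * (x * (M⟦c, Ξ⟧(x) + s * x ^ (n⟦c, c - 1⟧ - 1))) := by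
  rw [Pivot.eval_det_pivot, pencil_eq, Matrix.det_reindex_self,
    WLawArrow.det_arrow _ _ _ (fun i => (mblk_pos c Ξ hΞ hx.le i).ne'), schur_eq c hc Ξ hΞ s hx]
  congr 1
  exact Finset.prod_congr rfl fun i _ => mblk_eq c (hΞ i) x

/-- Hence at positive points the determinant has the sign of `M(x) + s x^{n_{c−1}−1}`: opposite signs of the latter
give a negative product of the former. [bookkeeping] -/
theorem eval_mul_eval_neg (c : ℕ) (hc : 1 ≤ c) {k : ℕ} (Ξ : Fin k → ℝ) (hΞ : ∀ i, 0 < Ξ i) (s : ℝ)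
    {x y : ℝ} (hx : 0 < x) (hy : 0 < y)
    (h : (M⟦c, Ξ⟧(x) + s * x ^ (n⟦c, c - 1⟧ - 1)) * (M⟦c, Ξ⟧(y) + s * y ^ (n⟦c, c - 1⟧ - 1)) < 0) :
    (Matrix.det (((X : ℝ[X]) ^ 1) • (rx[Jw⟦k⟧]).map Polynomial.C
        + ∑ l, ((X : ℝ[X]) ^ (dw⟦c⟧ l)) • (rx[Lw⟦c, Ξ, s⟧(l)]).map Polynomial.C)).eval x
      * (Matrix.det (((X : ℝ[X]) ^ 1) • (rx[Jw⟦k⟧]).map Polynomial.C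
        + ∑ l, ((X : ℝ[X]) ^ (dw⟦c⟧ l)) • (rx[Lw⟦c, Ξ, s⟧(l)]).map Polynomial.C)).eval y < 0 := by
  rw [det_pencil_eval c hc Ξ hΞ s hx, det_pencil_eval c hc Ξ hΞ s hy]
  have hPx : 0 < ∏ i, Ξ i / 2 * m⟦c⟧(x / Ξ i) :=
    Finset.prod_pos fun i _ => mul_pos (by have := hΞ i; positivity) (m_pos c (div_pos hx (hΞ i)).le)
  have hPy : 0 < ∏ i, Ξ i / 2 * m⟦c⟧(y / Ξ i) :=
    Finset.prod_pos fun i _ => mul_pos (by have := hΞ i; positivity) (m_pos c (div_pos hy (hΞ i)).le)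
  set A := M⟦c, Ξ⟧(x) + s * x ^ (n⟦c, c - 1⟧ - 1)
  set B := M⟦c, Ξ⟧(y) + s * y ^ (n⟦c, c - 1⟧ - 1)
  set Px := ∏ i, Ξ i / 2 * m⟦c⟧(x / Ξ i)
  set Py := ∏ i, Ξ i / 2 * m⟦c⟧(y / Ξ i)
  have : Px * (x * A) * (Py * (y * B)) = (Px * Py * (x * y)) * (A * B) := by ring
  rw [this]
  exact mul_neg_of_pos_of_neg (by positivity) h

end Summit.ValiantsHypothesis.ValiantsHypothesis.Theorems.LacunarySymmetroidMatrixDescartes.Pivot.PoleWeave
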